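import Summits.NavierStokesRegularity.NavierStokesRegularity.Theorems.ExtremiserTransienceNearExtremalTransienceSharpForm
import Summits.NavierStokesRegularity.NavierStokesRegularity.Theorems.ExtremiserTransienceNearExtremalTransienceBlocksToLog
import HarnessLib.Audit

/-!
# Skeleton of the crux `ExtremiserTransience.NearExtremalTransience` — line `birth`, v4 (SHARP NORMAL FORM)
(crux item `stmt-NavierStokesRegularity-21883`; BC3 birth skeleton of planner-ns-idea-5-g0-0, 2026-08-27; v1–v3 by the
prover seat `ns-et-p1` g0; v4 by `ns-et-p1` g2, 2026-08-28.)

THE LINE, v4. One registered stub, `stub_sharpLogMean` = the crux in its SHARP, ONSET-FREE, CANONICAL form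
(`Theorems.nearExtremalTransience_iff_sharp_onsetZero`, landed by g2): there is ONE universal `θ ∈ [0,1)` such that
along every Type-I singular classical Leray–Hopf rapidly-decaying-datum flow `u` on `[0,T)` EVERY minimal measurable
flow-wise coefficient `k₀` — i.e. the stretching efficiency `R(t) = |∫⟪ω,Du ω⟫|/(sup|u(t)|·‖ω(t)‖₂·‖∇ω(t)‖₂)`,
which exists (`DepletionLadder.exists_canonical_coefficient`) — has `∫_0^t k₀²/(T−τ) ≤ (θκ⋆)² log(T/(T−t)) + B`
for all `t ∈ [0,T)`, where `κ⋆ = sInf` of the universal depletion constants (itself universal,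
`DepletionLadder.sharpDepletion_is_universal`; `13/200 < κ⋆ ≤ (9+2√15)/42`). The composition
`NearExtremalTransience_of` is the landed equivalence; the stub is EQUIVALENT to the crux (nothing is lost, nothing
is added): at the present state of knowledge the crux is atomic — its content is exactly «the log-time quadratic mean
of `R(t)` along Type-I singular flows stays a uniform factor below the sharp static constant `κ⋆`».

Relation to v3 (`stub_blockSubextremal`: per-unit-log-block quadratic mean `≤ (θ₀κ)²` from an onset, for every
universal `κ`): v3 ⟹ v4 (`stub_sharpLogMean_of_blockSubextremal`, PROVED below from the landed
`Birth.stub_blocksToLog` p577560, minimality of `k₀`, `κ⋆ ∈ V`, and onset removal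
`DepletionLadder.logMean_bound_from_zero`); v4 is weaker than v3 exactly by allowing sparse recurrent near-extremal
blocks of zero log-density (the scenario «DSS orbit with isolated near-extremal episodes» kills v3 but not v4).
Status: `stub_blocksToLog` LANDED (p577560); θ = 1 endpoint, canonical coefficient, canonical form, endpoints
LANDED by g0 (p578195, p579353, p580852, p581839); g2 LANDED the sharp constant / sharp form / eventual form
(p588001 `…SharpConstant`, p588267 `…SharpForm`, p590185 `…SharpEventually`: crux ⟺ one `θ<1`, every Type-I
singular flow, eventually `∫_0^t R²/(T−τ) ≤ (θκ⋆)² log(T/(T−t))`) and the DSS-stratum (BC5) per-flow theory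
(p589291 `…Scaling`: `R` is scale invariant, log-periodic along DSS flows; p589620 `…DSSLogMean`: log-mean = period
average; p589984 `…DSSPerFlow`: per-flow `θ_u < 1` under non-attainment of `κ⋆`; p591021 `…DSSDichotomy` + p592007 `…DSSOrbit`:
unconditionally, per DSS flow either a.e. slice up to `T` is an exact maximiser or `θ_u < 1`; p591718 `…DSSRungForm`:
the BC5 rung ⟺ one uniform bound on the period mass of `R²`). `stub_sharpLogMean` OPEN = the crux
proper (research-level: attainment/structure of near-maximisers of `R`, exit estimate, uniformity over flows; see
`Lines/birth.md`). Navier–Stokes regularity is NOT proved by anything here.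
-/

noncomputable section

open Set MeasureTheory Filter Topology
open scoped InnerProductSpace RealInnerProductSpace ENNReal
open Literature.Analysis.FluidPDE

namespace Summit.NavierStokesRegularity.NavierStokesRegularity.Cruxes.NearExtremalTransience.Birth

open Summit.NavierStokesRegularity.NavierStokesRegularity.Theses.ExtremiserTransience
open Summit.NavierStokesRegularity.NavierStokesRegularity.Theorems
open Summit.NavierStokesRegularity.NavierStokesRegularity.Theorems.DepletionLadder

set_option linter.unusedVariables false
set_option linter.dupNamespace false

/-- **stub — `stub_sharpLogMean` (dynamics, XL; the crux proper in sharp normal form).** One universal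
`θ ∈ [0,1)`; along every Type-I singular classical Leray–Hopf rapidly-decaying-datum flow every minimal measurable
flow-wise depletion coefficient `k₀` (the stretching efficiency) satisfies
`∫_0^t k₀²/(T−τ) ≤ (θκ⋆)² log(T/(T−t)) + B` on `[0,T)`, `κ⋆ = sInf {universal depletion constants}`. [status: open] -/
theorem stub_sharpLogMean :
    ∃ θ : ℝ, 0 ≤ θ ∧ θ < 1 ∧ ∀ (C ν T : ℝ), 0 < C → 0 < ν → 0 < T → ∀ (u : ℝ → EuclideanSpace ℝ (Fin 3) → EuclideanSpace ℝ (Fin 3)) (p : ℝ → EuclideanSpace ℝ (Fin 3) → ℝ), Literature.Analysis.FluidPDE.IsClassicalNSSolutionOn (Set.Ico 0 T) ν 0 u p → Literature.Analysis.FluidPDE.IsLerayHopfOn T ν 0 (u 0) u → Literature.Analysis.FluidPDE.HasRapidSpatialDecay (u 0) → (∀ᶠ t in 𝓝[<] T, ∀ x, Real.sqrt (T - t) * ‖u t x‖ ≤ C * Real.sqrt ν) → ¬ Literature.Analysis.FluidPDE.HasSmoothExtensionPast ν 0 u T → ∀ k₀ : ℝ → ℝ, Measurable k₀ → (∀ τ,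 0 ≤ k₀ τ ∧ k₀ τ ≤ 1) → (∀ t ∈ Set.Ico 0 T, ∀ M : ℝ, (∀ x, ‖u t x‖ ≤ M) → |∫ x, ⟪Literature.Analysis.FluidPDE.curl (u t) x, fderiv ℝ (u t) x (Literature.Analysis.FluidPDE.curl (u t) x)⟫_ℝ| ≤ k₀ t * M * Real.sqrt (∫ x, ‖Literature.Analysis.FluidPDE.curl (u t) x‖ ^ 2) * Real.sqrt (∫ x, Literature.Analysis.FluidPDE.frobeniusNormSq (fderiv ℝ (Literature.Analysis.FluidPDE.curl (u t)) x))) → (∀ t ∈ Set.Ico 0 T, ∀ c : ℝ, 0 ≤ c → (∀ M : ℝ, (∀ x, ‖u t x‖ ≤ M) → |∫ x, ⟪Literature.Analysis.FluidPDE.curl (u t) x, fderiv ℝ (u t) x (Literature.Analysis.FluidPDE.curl (u t) x)⟫_ℝ| ≤ c * M * Real.sqrt (∫ x, ‖Literature.Analysis.FluidPDE.curl (u t) x‖ ^ 2) * Real.sqrt (∫ x, Literature.Analysis.FluidPDE.frobeniusNormSq (fderiv ℝ (Literature.Analysis.FluidPDE.curl (u t)) x))) → k₀ t ≤ c) → ∃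 B : ℝ, ∀ t ∈ Set.Ico 0 T, ∫ τ in (0 : ℝ)..t, k₀ τ ^ 2 / (T - τ) ≤ (θ * (sInf {κ : ℝ | (∀ (v : EuclideanSpace ℝ (Fin 3) → EuclideanSpace ℝ (Fin 3)) (M B : ℝ), ContDiff ℝ (⊤ : ℕ∞) v → Literature.Analysis.FluidPDE.VectorCalculus.IsDivFree v → (∀ x, ‖v x‖ ≤ M) → (∀ x, ‖fderiv ℝ v x‖ ≤ B) → (∫⁻ x, ‖iteratedFDeriv ℝ 0 v x‖ₑ ^ 2 < ⊤) → (∫⁻ x, ‖iteratedFDeriv ℝ 1 v x‖ₑ ^ 2 < ⊤) → (∫⁻ x, ‖iteratedFDeriv ℝ 2 v x‖ₑ ^ 2 < ⊤) → |∫ x, ⟪Literature.Analysis.FluidPDE.curl v x, fderiv ℝ v x (Literature.Analysis.FluidPDE.curl v x)⟫_ℝ| ≤ κ * M * Real.sqrt (∫ x, ‖Literature.Analysis.FluidPDE.curl v x‖ ^ 2) * Real.sqrt (∫ x, Literature.Analysis.FluidPDE.frobeniusNormSq (fderiv ℝ (Literature.Analysis.FluidPDE.curl v) x)))})) ^ 2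 * Real.log (T / (T - t)) + B := by
  sorry

/-- **Composition (closed modulo the stub).** `NearExtremalTransience` from `stub_sharpLogMean` BY NAME, through the
landed equivalence `Theorems.nearExtremalTransience_iff_sharp_onsetZero`. [folklore] -/
theorem NearExtremalTransience_of : NearExtremalTransience :=
  nearExtremalTransience_iff_sharp_onsetZero.2 stub_sharpLogMean

/-- **v3 ⟹ v4.** The registered v3 stub `stub_blockSubextremal` (statement verbatim as hypothesis) implies
`stub_sharpLogMean`: instantiate v3 at the universal constant `κ⋆` (`sharpDepletion_is_universal`), compare the
minimal `k₀` with v3's coefficient on `[t₁,T)`, sum the unit log-blocks (`Birth.stub_blocksToLog`, p577560) and remove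
the onset (`logMean_bound_from_zero`). So v4 asks for no more than v3 did. [folklore] -/
theorem stub_sharpLogMean_of_blockSubextremal
    (h3 : ∃ θ₀ : ℝ, 0 ≤ θ₀ ∧ θ₀ < 1 ∧ ∀ κ : ℝ, (∀ (v : EuclideanSpace ℝ (Fin 3) → EuclideanSpace ℝ (Fin 3)) (M B : ℝ), ContDiff ℝ (⊤ : ℕ∞) v → Literature.Analysis.FluidPDE.VectorCalculus.IsDivFree v → (∀ x, ‖v x‖ ≤ M) → (∀ x, ‖fderiv ℝ v x‖ ≤ B) → (∫⁻ x, ‖iteratedFDeriv ℝ 0 v x‖ₑ ^ 2 < ⊤) → (∫⁻ x, ‖iteratedFDeriv ℝ 1 v x‖ₑ ^ 2 < ⊤) → (∫⁻ x, ‖iteratedFDeriv ℝ 2 v x‖ₑ ^ 2 < ⊤) → |∫ x, ⟪Literature.Analysis.FluidPDE.curl v x, fderiv ℝ v x (Literature.Analysis.FluidPDE.curl v x)⟫_ℝ| ≤ κ * M * Real.sqrt (∫ x, ‖Literature.Analysis.FluidPDE.curl v x‖ ^ 2) * Real.sqrt (∫ x, Literature.Analysis.FluidPDE.frobeniusNormSq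 (fderiv ℝ (Literature.Analysis.FluidPDE.curl v) x))) → ∀ (C ν T : ℝ), 0 < C → 0 < ν → 0 < T → ∀ (u : ℝ → EuclideanSpace ℝ (Fin 3) → EuclideanSpace ℝ (Fin 3)) (p : ℝ → EuclideanSpace ℝ (Fin 3) → ℝ), Literature.Analysis.FluidPDE.IsClassicalNSSolutionOn (Set.Ico 0 T) ν 0 u p → Literature.Analysis.FluidPDE.IsLerayHopfOn T ν 0 (u 0) u → Literature.Analysis.FluidPDE.HasRapidSpatialDecay (u 0) → (∀ᶠ t in 𝓝[<] T, ∀ x, Real.sqrt (T - t) * ‖u t x‖ ≤ C * Real.sqrt ν) → ¬ Literature.Analysis.FluidPDE.HasSmoothExtensionPast ν 0 u T → ∃ t₁ ∈ Set.Ico 0 T, ∃ (k : ℝ → ℝ), Measurable k ∧ (∀ τ, 0 ≤ k τ ∧ k τ ≤ 1) ∧ (∀ t ∈ Set.Ico t₁ T, ∀ M : ℝ, (∀ x, ‖u t x‖ ≤ M) → |∫ x, ⟪Literature.Analysis.FluidPDE.curl (u t) x, fderiv ℝ (u t) x (Literature.Analysis.FluidPDE.curl (u t) x)⟫_ℝ|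 ≤ k t * M * Real.sqrt (∫ x, ‖Literature.Analysis.FluidPDE.curl (u t) x‖ ^ 2) * Real.sqrt (∫ x, Literature.Analysis.FluidPDE.frobeniusNormSq (fderiv ℝ (Literature.Analysis.FluidPDE.curl (u t)) x))) ∧ (∀ t ∈ Set.Ico t₁ T, IntervalIntegrable (fun τ => k τ ^ 2 / (T - τ)) MeasureTheory.volume t₁ t) ∧ (∀ n : ℕ, ∫ τ in (T - (T - t₁) * Real.exp (-(n : ℝ)))..(T - (T - t₁) * Real.exp (-((n : ℝ) + 1))), k τ ^ 2 / (T - τ) ≤ (θ₀ * κ) ^ 2)) :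
    ∃ θ : ℝ, 0 ≤ θ ∧ θ < 1 ∧ ∀ (C ν T : ℝ), 0 < C → 0 < ν → 0 < T → ∀ (u : ℝ → EuclideanSpace ℝ (Fin 3) → EuclideanSpace ℝ (Fin 3)) (p : ℝ → EuclideanSpace ℝ (Fin 3) → ℝ), Literature.Analysis.FluidPDE.IsClassicalNSSolutionOn (Set.Ico 0 T) ν 0 u p → Literature.Analysis.FluidPDE.IsLerayHopfOn T ν 0 (u 0) u → Literature.Analysis.FluidPDE.HasRapidSpatialDecay (u 0) → (∀ᶠ t in 𝓝[<] T, ∀ x, Real.sqrt (T - t) * ‖u t x‖ ≤ C * Real.sqrt ν) → ¬ Literature.Analysis.FluidPDE.HasSmoothExtensionPast ν 0 u T → ∀ k₀ : ℝ → ℝ, Measurable k₀ → (∀ τ, 0 ≤ k₀ τ ∧ k₀ τ ≤ 1) → (∀ t ∈ Set.Ico 0 T, ∀ M : ℝ, (∀ x, ‖u t x‖ ≤ M) → |∫ x, ⟪Literature.Analysis.FluidPDE.curl (u t) x, fderiv ℝ (u t) x (Literature.Analysis.FluidPDE.curl (u t) x)⟫_ℝ| ≤ k₀ t * M * Real.sqrt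 (∫ x, ‖Literature.Analysis.FluidPDE.curl (u t) x‖ ^ 2) * Real.sqrt (∫ x, Literature.Analysis.FluidPDE.frobeniusNormSq (fderiv ℝ (Literature.Analysis.FluidPDE.curl (u t)) x))) → (∀ t ∈ Set.Ico 0 T, ∀ c : ℝ, 0 ≤ c → (∀ M : ℝ, (∀ x, ‖u t x‖ ≤ M) → |∫ x, ⟪Literature.Analysis.FluidPDE.curl (u t) x, fderiv ℝ (u t) x (Literature.Analysis.FluidPDE.curl (u t) x)⟫_ℝ| ≤ c * M * Real.sqrt (∫ x, ‖Literature.Analysis.FluidPDE.curl (u t) x‖ ^ 2) * Real.sqrt (∫ x, Literature.Analysis.FluidPDE.frobeniusNormSq (fderiv ℝ (Literature.Analysis.FluidPDE.curl (u t)) x))) → k₀ t ≤ c) → ∃ B : ℝ, ∀ t ∈ Set.Ico 0 T, ∫ τ in (0 : ℝ)..t, k₀ τ ^ 2 / (T - τ) ≤ (θ * (sInf {κ : ℝ | (∀ (v : EuclideanSpace ℝ (Fin 3) → EuclideanSpace ℝ (Fin 3)) (M B : ℝ), ContDiff ℝ (⊤ : ℕ∞) v → Literature.Analysis.FluidPDE.VectorCalculus.IsDivFree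 v → (∀ x, ‖v x‖ ≤ M) → (∀ x, ‖fderiv ℝ v x‖ ≤ B) → (∫⁻ x, ‖iteratedFDeriv ℝ 0 v x‖ₑ ^ 2 < ⊤) → (∫⁻ x, ‖iteratedFDeriv ℝ 1 v x‖ₑ ^ 2 < ⊤) → (∫⁻ x, ‖iteratedFDeriv ℝ 2 v x‖ₑ ^ 2 < ⊤) → |∫ x, ⟪Literature.Analysis.FluidPDE.curl v x, fderiv ℝ v x (Literature.Analysis.FluidPDE.curl v x)⟫_ℝ| ≤ κ * M * Real.sqrt (∫ x, ‖Literature.Analysis.FluidPDE.curl v x‖ ^ 2) * Real.sqrt (∫ x, Literature.Analysis.FluidPDE.frobeniusNormSq (fderiv ℝ (Literature.Analysis.FluidPDE.curl v) x)))})) ^ 2 * Real.log (T / (T - t)) + B := by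
  obtain ⟨θ₀, hθ0, hθ1, H⟩ := h3
  refine ⟨θ₀, hθ0, hθ1, ?_⟩
  intro C ν T hC hν hT u p hsol hLH hdec hrate hext k₀ hk₀m hk₀01 hcl hmin
  obtain ⟨t₁, ht₁, k, hkm, hk01, hflow, hii, hblock⟩ :=
    H _ sharpDepletion_is_universal C ν T hC hν hT u p hsol hLH hdec hrate hext
  -- the minimal coefficient is below `k` on `[t₁,T)`, block by block
  have hblock₀ : ∀ n : ℕ, ∫ τ in (T - (T - t₁) * Real.exp (-(n : ℝ)))..(T - (T - t₁) * Real.exp (-((n : ℝ) + 1))),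
      k₀ τ ^ 2 / (T - τ) ≤ (θ₀ * sInf {κ : ℝ | (∀ (v : EuclideanSpace ℝ (Fin 3) → EuclideanSpace ℝ (Fin 3)) (M B : ℝ), ContDiff ℝ (⊤ : ℕ∞) v → Literature.Analysis.FluidPDE.VectorCalculus.IsDivFree v → (∀ x, ‖v x‖ ≤ M) → (∀ x, ‖fderiv ℝ v x‖ ≤ B) → (∫⁻ x, ‖iteratedFDeriv ℝ 0 v x‖ₑ ^ 2 < ⊤) → (∫⁻ x, ‖iteratedFDeriv ℝ 1 v x‖ₑ ^ 2 < ⊤) → (∫⁻ x, ‖iteratedFDeriv ℝ 2 v x‖ₑ ^ 2 < ⊤) → |∫ x, ⟪Literature.Analysis.FluidPDE.curl v x, fderiv ℝ v x (Literature.Analysis.FluidPDE.curl v x)⟫_ℝ| ≤ κ * M * Real.sqrt (∫ x, ‖Literature.Analysis.FluidPDE.curl v x‖ ^ 2) * Real.sqrt (∫ x, Literature.Analysis.FluidPDE.frobeniusNormSq (fderiv ℝ (Literature.Analysis.FluidPDE.curl v) x)))}) ^ 2 := by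
    intro n
    refine le_trans ?_ (hblock n)
    obtain ⟨h1, h2, h3⟩ := logBlock_endpoints ht₁.2 n
    refine intervalIntegral.integral_mono_on h2
      (intervalIntegrable_coeff_sq_div hk₀m hk₀01 h2 h3) (intervalIntegrable_coeff_sq_div hkm hk01 h2 h3)
      fun τ hτ => ?_
    have hτ' : τ ∈ Set.Ico t₁ T := ⟨h1.trans hτ.1, lt_of_le_of_lt hτ.2 h3⟩
    have hle : k₀ τ ≤ k τ :=
      hmin τ ⟨ht₁.1.trans hτ'.1, hτ'.2⟩ (k τ) (hk01 τ).1 (hflow τ hτ')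
    exact div_le_div_of_nonneg_right (pow_le_pow_left₀ (hk₀01 τ).1 hle 2) (sub_pos.2 hτ'.2).le
  have hg0 : ∀ τ ∈ Set.Ico t₁ T, 0 ≤ k₀ τ ^ 2 / (T - τ) := fun τ hτ =>
    div_nonneg (sq_nonneg _) (sub_nonneg.2 hτ.2.le)
  have hii₀ : ∀ t ∈ Set.Ico t₁ T, IntervalIntegrable (fun τ => k₀ τ ^ 2 / (T - τ)) volume t₁ t :=
    fun t ht => intervalIntegrable_coeff_sq_div hk₀m hk₀01 ht.1 ht.2
  have hmean := Summit.NavierStokesRegularity.NavierStokesRegularity.Theorems.NearExtremalTransience.Birth.stub_blocksToLog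
    (fun τ => k₀ τ ^ 2 / (T - τ)) t₁ T ((θ₀ * sInf {κ : ℝ | (∀ (v : EuclideanSpace ℝ (Fin 3) → EuclideanSpace ℝ (Fin 3)) (M B : ℝ), ContDiff ℝ (⊤ : ℕ∞) v → Literature.Analysis.FluidPDE.VectorCalculus.IsDivFree v → (∀ x, ‖v x‖ ≤ M) → (∀ x, ‖fderiv ℝ v x‖ ≤ B) → (∫⁻ x, ‖iteratedFDeriv ℝ 0 v x‖ₑ ^ 2 < ⊤) → (∫⁻ x, ‖iteratedFDeriv ℝ 1 v x‖ₑ ^ 2 < ⊤) → (∫⁻ x, ‖iteratedFDeriv ℝ 2 v x‖ₑ ^ 2 < ⊤) → |∫ x, ⟪Literature.Analysis.FluidPDE.curl v x, fderiv ℝ v x (Literature.Analysis.FluidPDE.curl v x)⟫_ℝ| ≤ κ * M * Real.sqrt (∫ x, ‖Literature.Analysis.FluidPDE.curl v x‖ ^ 2) * Real.sqrt (∫ x, Literature.Analysis.FluidPDE.frobeniusNormSq (fderiv ℝ (Literature.Analysis.FluidPDE.curl v) x)))}) ^ 2) ht₁.2 (sq_nonneg _) hg0 hii₀ hblock₀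
  exact logMean_bound_from_zero hk₀m hk₀01 ht₁ (sq_nonneg _) hmean

end Summit.NavierStokesRegularity.NavierStokesRegularity.Cruxes.NearExtremalTransience.Birth

end
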